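import Summits.Ventures.Crystal3D.Bulk.LocalTwelve
import Summits.Ventures.Crystal3D.StickySpheres.RadiusOne
import Literature.Barriers.AtomisticToContinuum.FlexibleKissingArrangements
import HarnessLib

/-!
# Negative control: a saturated ball whose shell is NOT close-packed (the icosahedral cluster)

HONEST FRAMING. Part of the venture `Summits/Ventures/Crystal3D` (cell `pub-crystal3d`, phase 2;
seat typer-bulk-2; the red team's checklist R-4 item "icosahedral-shell negative unit test").
The seat typer-bulk's `IsClosePackedShell x i` (`Bulk/LocalTwelve.lean`) asks that the doubled
contact vectors of ball `i` be congruent to the cuboctahedral or twisted-cuboctahedral pattern;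
`Bulk/ClosePackedWitness.lean` shows it is SATISFIABLE (fcc nucleus). This file shows it is NOT
IMPLIED by saturation: the thirteen-ball icosahedral cluster (integer model `(0, ±28, ±45)/53` and
cyclic permutations around the origin, the tree's `icoInt` of
`Literature/Barriers/AtomisticToContinuum/FlexibleKissingArrangements.lean`) is a unit packing
whose central ball has twelve contacts and NO two of whose twelve neighbours touch, whereas each of
the two patterns contains a touching pair (`exists_dist_eq_one_fcc/hcp`); a linear isometry would
carry that pair to two touching neighbours. Hence `¬ IsClosePackedShell`, i.e. the centre is a
twelve-coordinated member of `nonClosePacked` — the set `B` of the cell's counting is not vacuous.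
All metric facts are integer arithmetic (`decide`) transported by `StickySpheres/RadiusOne.lean`.
NO crystallization claim is made; the cluster is not claimed to be a ground state (it has 12
contacts; `C(13) = 36`).
-/

noncomputable section

open scoped BigOperators
open Finset

namespace Summit.Ventures.Crystal3D

open Literature.Geometry.DiscreteGeometry (sqNormInt fccKissingPattern hcpKissingPattern
  IsArrangedIn)
open Literature.Barriers.AtomisticToContinuum (intConfig exists_dist_eq_one_fcc
  exists_dist_eq_one_hcp)

namespace IcoCluster

/-- Integer model (scale `53`) of the centred icosahedral cluster: the origin and the twelve
vectors `(0, ±28, ±45)` with cyclic permutations (`28² + 45² = 53²`). -/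
def coeff : Fin 13 → Fin 3 → ℤ :=
  ![![0, 0, 0],
    ![0, 28, 45], ![0, 28, -45], ![0, -28, 45], ![0, -28, -45],
    ![28, 45, 0], ![28, -45, 0], ![-28, 45, 0], ![-28, -45, 0],
    ![45, 0, 28], ![45, 0, -28], ![-45, 0, 28], ![-45, 0, -28]]

/-- Separation: distinct balls are at integer squared distance `≥ 2809 = 53²`. -/
theorem sep : ∀ i j : Fin 13, i ≠ j → (2809 : ℤ) ≤ sqNormInt (coeff i - coeff j) := by
  decide

/-- The twelve outer balls touch the centre (squared distance exactly `53²`). -/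
theorem touch_center : ∀ j : Fin 13, j ≠ 0 → sqNormInt (coeff 0 - coeff j) = 2809 := by
  decide

/-- No two outer balls touch (their squared distances are `≥ 3098 > 2809`). -/
theorem outer_apart : ∀ j k : Fin 13, j ≠ 0 → k ≠ 0 → j ≠ k →
    sqNormInt (coeff j - coeff k) ≠ 2809 := by
  decide

/-- The centred icosahedral cluster as a configuration of unit-diameter balls (scale `1/53`). -/
def config : Fin 13 → EuclideanSpace ℝ (Fin 3) :=
  intConfig coeff (1 / Real.sqrt ((2809 : ℕ) : ℝ))

/-- It is a unit packing. -/
theorem isUnitPacking_config : IsUnitPacking config :=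
  isUnitPacking_intConfig coeff (m := 2809) (by norm_num) sep

/-- Distances: `dist (x i) (x j) = 1 ↔ |c i - c j|² = 2809`. -/
theorem dist_config_eq_one_iff (i j : Fin 13) :
    dist (config i) (config j) = 1 ↔ sqNormInt (coeff i - coeff j) = 2809 := by
  rw [config, dist_intConfig_inv_sqrt coeff (m := 2809) (by norm_num), Real.sqrt_eq_one,
    div_eq_one_iff_eq (by norm_num : ((2809 : ℕ) : ℝ) ≠ 0)]
  constructor
  · intro h; exact_mod_cast h
  · intro h; exact_mod_cast h

/-- The contact neighbours of the centre are exactly the twelve outer balls. -/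
theorem contactNeighbors_config_zero : contactNeighbors config 0 = univ.filter fun j => j ≠ 0 := by
  ext j
  simp only [mem_contactNeighbors, mem_filter, mem_univ, true_and]
  constructor
  · exact fun h => h.1
  · exact fun hj => ⟨hj, (dist_config_eq_one_iff 0 j).2 (touch_center j hj)⟩

/-- **The centre is saturated**: twelve contacts. -/
theorem coordination_config_zero : coordination config 0 = 12 := by
  rw [coordination, contactNeighbors_config_zero]
  decide

/-- No two contact neighbours of the centre touch each other. -/
theorem neighbors_not_touching {j k : Fin 13} (hj : j ∈ contactNeighbors config 0)
    (hk : k ∈ contactNeighbors config 0) (hjk : j ≠ k) : dist (config j) (config k) ≠ 1 := by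
  rw [contactNeighbors_config_zero, mem_filter] at hj hk
  rw [Ne, dist_config_eq_one_iff]
  exact outer_apart j k hj.2 hk.2 hjk

/-- A pattern with a touching pair cannot be the pattern of the centre's shell: a linear isometry
would carry the pair to two touching neighbours. -/
theorem not_isArrangedIn_of_touching_pair {P : Finset (EuclideanSpace ℝ (Fin 3))}
    (hP : ∃ p ∈ P, ∃ q ∈ P, dist p q = 1) : ¬ IsArrangedIn (contactShell config 0) P := by
  rintro ⟨A, hA⟩
  obtain ⟨p, hp, q, hq, hpq⟩ := hP
  have hmem : ∀ r ∈ P, ∃ j ∈ contactNeighbors config 0, (2 : ℝ) • (config j - config 0) =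
      (2 : ℝ) • A r := fun r hr => by
    have : (2 : ℝ) • A r ∈ contactShell config 0 := by
      rw [hA]; exact ⟨r, hr, rfl⟩
    exact mem_contactShell.1 this
  obtain ⟨j, hj, hj'⟩ := hmem p hp
  obtain ⟨k, hk, hk'⟩ := hmem q hq
  have h2 : Function.Injective fun v : EuclideanSpace ℝ (Fin 3) => (2 : ℝ) • v :=
    smul_right_injective _ (two_ne_zero (α := ℝ))
  have hjp : config j - config 0 = A p := h2 hj'
  have hkq : config k - config 0 = A q := h2 hk'
  have hdist : dist (config j) (config k) = 1 := by
    rw [← hpq, ← A.dist_map p q, ← hjp, ← hkq, dist_sub_right]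
  have hjk : j ≠ k := by
    rintro rfl
    rw [dist_self] at hdist
    exact zero_ne_one hdist
  exact neighbors_not_touching hj hk hjk hdist

end IcoCluster

open IcoCluster

/-- **The centre of the icosahedral cluster is saturated but NOT close-packed.** -/
theorem not_isClosePackedShell_icoCluster : ¬ IsClosePackedShell config 0 := by
  rintro (h | h)
  · exact not_isArrangedIn_of_touching_pair exists_dist_eq_one_fcc h
  · exact not_isArrangedIn_of_touching_pair exists_dist_eq_one_hcp h

/-- **Negative control for the defect predicate**: twelve contacts do not imply a close-packed
shell — there is a unit packing of thirteen balls in `ℝ³` with a ball of coordination twelve that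
is a member of `nonClosePacked` (the icosahedral cluster). So in the cell's counting the set `B`
of saturated non-close-packed balls is not vacuous, and `BulkCrystallization3D` is not a
restatement of "all but `O(N^{2/3})` balls are saturated". -/
theorem exists_saturated_not_isClosePackedShell :
    ∃ x : Fin 13 → EuclideanSpace ℝ (Fin 3), IsUnitPacking x ∧ coordination x 0 = 12 ∧
      ¬ IsClosePackedShell x 0 ∧ (0 : Fin 13) ∈ nonClosePacked x :=
  ⟨config, isUnitPacking_config, coordination_config_zero, not_isClosePackedShell_icoCluster,
    mem_nonClosePacked.2 not_isClosePackedShell_icoCluster⟩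

end Summit.Ventures.Crystal3D

end
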